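import Literature.Analysis.Fourier.PowerKernelFourierTransform
import Literature.Analysis.Fourier.PowerKernelFourierDecay
import Mathlib.Analysis.Fourier.FourierTransformDeriv
import Mathlib.Analysis.SpecialFunctions.JapaneseBracket
import HarnessLib

/-!
# The Fourier transform of the vector power kernels `⟪c, v⟫ (‖v‖² + t²)^{-s}`

Topic `Literature/Analysis/Fourier`, continuing `PowerKernelFourierTransform`
(`fourierIntegral_normSq_add_sq_rpow_neg`) and `PowerKernelFourierDecay`
(`integrable_normSq_add_sq_rpow_neg`). Everything here is PROVED (no named facts, no definitions).

The in-plane components of lattice sums of a central force kernel `F(z) = φ(‖z‖²) z` have, on a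
layer at height `t`, the slices `v ↦ ⟪c, v⟫ φ(‖v‖² + t²)`; for the inverse powers
`φ(r) = r^{-s}` these are gradients,
`⟪c, v⟫ (‖v‖² + t²)^{-s} = -(2(s-1))⁻¹ ∂_c (‖v‖² + t²)^{-(s-1)}`, so their Fourier transform is
`2πi ⟪c, w⟫` times that of the scalar kernel of exponent `s - 1` (Mathlib's
`Real.fourier_fderiv`, the Fourier transform of a Fréchet derivative):

* `hasFDerivAt_normSq_add_sq_rpow_neg` — the gradient of `(‖v‖² + t²)^{-σ}`;
* `integrable_norm_mul_normSq_add_sq_rpow_neg`, `integrable_inner_mul_normSq_add_sq_rpow_neg` —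
  integrability of `‖v‖ (‖v‖² + t²)^{-s}` and of the vector kernel for `s > d/2 + 1/2`;
* `integrable_fderiv_normSq_add_sq_rpow_neg` — integrability of the (complexified) gradient of
  the scalar kernel of exponent `s - 1` for `s - 1 > d/2`;
* **`fourierIntegral_inner_mul_normSq_add_sq_rpow_neg`** — for `s - 1 > d/2`, `t > 0`:
  `𝓕[⟪c, ·⟫ (‖·‖² + t²)^{-s}](w) = -(π i ⟪c, w⟫ / (s - 1)) · 𝓕[(‖·‖² + t²)^{-(s-1)}](w)`.

## References

* E. M. Stein, G. Weiss, *Introduction to Fourier Analysis on Euclidean Spaces*, Princeton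
  University Press 1971, Ch. I §1 (Fourier transform of derivatives, Theorem 1.8; the
  Gauss–Weierstrass and Poisson kernels). [cite: SteinWeiss1971, Ch. I §1]
-/

noncomputable section

namespace Literature.Analysis.Fourier

open _root_.MeasureTheory Set Filter
open scoped FourierTransform Real Topology RealInnerProductSpace

variable {V : Type*} [NormedAddCommGroup V] [InnerProductSpace ℝ V] [FiniteDimensional ℝ V]
  [MeasurableSpace V] [BorelSpace V]

omit [InnerProductSpace ℝ V] [FiniteDimensional ℝ V] [MeasurableSpace V] [BorelSpace V] in
/-- The power kernel `v ↦ (‖v‖² + t²)^p` is continuous for `t ≠ 0` (any real exponent).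
[folklore] -/
theorem continuous_normSq_add_sq_rpow {t : ℝ} (ht : t ≠ 0) (p : ℝ) :
    Continuous fun v : V => (‖v‖ ^ 2 + t ^ 2) ^ p :=
  Continuous.rpow_const (by fun_prop) fun v =>
    Or.inl (by positivity : (0 : ℝ) < ‖v‖ ^ 2 + t ^ 2).ne'

omit [FiniteDimensional ℝ V] [MeasurableSpace V] [BorelSpace V] in
/-- The gradient of the scalar power kernel: `d/dv (‖v‖² + t²)^{-σ} = -2σ (‖v‖² + t²)^{-σ-1} ⟪v, ·⟫`
(`t ≠ 0`). [folklore] -/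
theorem hasFDerivAt_normSq_add_sq_rpow_neg {σ t : ℝ} (ht : t ≠ 0) (v : V) :
    HasFDerivAt (fun v : V => (‖v‖ ^ 2 + t ^ 2) ^ (-σ))
      ((-(2 * σ) * (‖v‖ ^ 2 + t ^ 2) ^ (-σ - 1)) • (innerSL ℝ v)) v := by
  have h1 : HasFDerivAt (fun v : V => ‖v‖ ^ 2 + t ^ 2) (2 • innerSL ℝ v) v :=
    (hasStrictFDerivAt_norm_sq v).hasFDerivAt.add_const _
  have hpos : ‖v‖ ^ 2 + t ^ 2 ≠ 0 := (by positivity : (0 : ℝ) < ‖v‖ ^ 2 + t ^ 2).ne'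
  refine (h1.rpow_const (p := -σ) (Or.inl hpos)).congr_fderiv ?_
  rw [two_smul, smul_add, ← add_smul]
  congr 1
  ring

omit [FiniteDimensional ℝ V] [MeasurableSpace V] [BorelSpace V] in
/-- The gradient of the complexified scalar power kernel `v ↦ ((‖v‖² + t²)^{-σ} : ℂ)`:
the real gradient followed by the inclusion `ℝ → ℂ`. [folklore] -/
theorem hasFDerivAt_ofReal_normSq_add_sq_rpow_neg {σ t : ℝ} (ht : t ≠ 0) (v : V) :
    HasFDerivAt (fun v : V => (((‖v‖ ^ 2 + t ^ 2) ^ (-σ) : ℝ) : ℂ))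
      (Complex.ofRealCLM.comp
        ((-(2 * σ) * (‖v‖ ^ 2 + t ^ 2) ^ (-σ - 1)) • (innerSL ℝ v))) v :=
  Complex.ofRealCLM.hasFDerivAt.comp v (hasFDerivAt_normSq_add_sq_rpow_neg ht v)

/-- `‖v‖ (‖v‖² + t²)^{-s}` is integrable on `V` for `s > d/2 + 1/2`, `t ≠ 0`: it is at most
`(‖v‖² + t²)^{-(s - 1/2)}` (`integrable_normSq_add_sq_rpow_neg`). [folklore] -/
theorem integrable_norm_mul_normSq_add_sq_rpow_neg {s t : ℝ}
    (hs : (Module.finrank ℝ V : ℝ) / 2 + 1 / 2 < s) (ht : t ≠ 0) :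
    Integrable fun v : V => ‖v‖ * (‖v‖ ^ 2 + t ^ 2) ^ (-s) := by
  have hs' : (Module.finrank ℝ V : ℝ) / 2 < s - 1 / 2 := by linarith
  refine (integrable_normSq_add_sq_rpow_neg hs' ht).mono'
    (continuous_norm.mul (continuous_normSq_add_sq_rpow ht _)).aestronglyMeasurable
    (ae_of_all _ fun v => ?_)
  have hr : 0 < ‖v‖ ^ 2 + t ^ 2 := by positivity
  have hvle : ‖v‖ ≤ (‖v‖ ^ 2 + t ^ 2) ^ (1 / (2 : ℝ)) :=
    calc ‖v‖ = Real.sqrt (‖v‖ ^ 2) := (Real.sqrt_sq (norm_nonneg v)).symm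
      _ ≤ Real.sqrt (‖v‖ ^ 2 + t ^ 2) := Real.sqrt_le_sqrt (by nlinarith)
      _ = (‖v‖ ^ 2 + t ^ 2) ^ (1 / (2 : ℝ)) := Real.sqrt_eq_rpow _
  rw [Real.norm_eq_abs, abs_of_nonneg (by positivity)]
  calc ‖v‖ * (‖v‖ ^ 2 + t ^ 2) ^ (-s)
      ≤ (‖v‖ ^ 2 + t ^ 2) ^ (1 / (2 : ℝ)) * (‖v‖ ^ 2 + t ^ 2) ^ (-s) :=
        mul_le_mul_of_nonneg_right hvle (Real.rpow_nonneg hr.le _)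
    _ = (‖v‖ ^ 2 + t ^ 2) ^ (-(s - 1 / 2)) := by
        rw [← Real.rpow_add hr]
        congr 1
        ring

/-- The vector kernel `⟪c, v⟫ (‖v‖² + t²)^{-s}` is integrable for `s > d/2 + 1/2`, `t ≠ 0`.
[folklore] -/
theorem integrable_inner_mul_normSq_add_sq_rpow_neg {s t : ℝ}
    (hs : (Module.finrank ℝ V : ℝ) / 2 + 1 / 2 < s) (ht : t ≠ 0) (c : V) :
    Integrable fun v : V => ⟪c, v⟫ * (‖v‖ ^ 2 + t ^ 2) ^ (-s) := by
  refine ((integrable_norm_mul_normSq_add_sq_rpow_neg hs ht).const_mul ‖c‖).mono'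
    ((continuous_const.inner continuous_id).mul
      (continuous_normSq_add_sq_rpow ht _)).aestronglyMeasurable
    (ae_of_all _ fun v => ?_)
  have hr : 0 < ‖v‖ ^ 2 + t ^ 2 := by positivity
  rw [norm_mul, Real.norm_eq_abs, Real.norm_eq_abs, abs_of_nonneg (Real.rpow_nonneg hr.le _),
    ← mul_assoc]
  exact mul_le_mul_of_nonneg_right (abs_real_inner_le_norm c v) (Real.rpow_nonneg hr.le _)

/-- The Fréchet derivative of the complexified scalar kernel `v ↦ ((‖v‖² + t²)^{-(s-1)} : ℂ)` is
integrable for `s - 1 > d/2` (indeed for `s > d/2 + 1/2`), `t ≠ 0`: its operator norm is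
`2(s-1) ‖v‖ (‖v‖² + t²)^{-s}`. [folklore] -/
theorem integrable_fderiv_normSq_add_sq_rpow_neg {s t : ℝ}
    (hs : (Module.finrank ℝ V : ℝ) / 2 < s - 1) (ht : t ≠ 0) :
    Integrable (fderiv ℝ (fun v : V => (((‖v‖ ^ 2 + t ^ 2) ^ (-(s - 1)) : ℝ) : ℂ))) := by
  have hd0 : (0 : ℝ) ≤ (Module.finrank ℝ V : ℝ) / 2 := by positivity
  have hs1 : 0 < s - 1 := hd0.trans_lt hs
  have hs' : (Module.finrank ℝ V : ℝ) / 2 + 1 / 2 < s := by linarith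
  have hfderiv : fderiv ℝ (fun v : V => (((‖v‖ ^ 2 + t ^ 2) ^ (-(s - 1)) : ℝ) : ℂ)) =
      fun v : V => Complex.ofRealCLM.comp
        ((-(2 * (s - 1)) * (‖v‖ ^ 2 + t ^ 2) ^ (-(s - 1) - 1)) • (innerSL ℝ v)) :=
    funext fun v => (hasFDerivAt_ofReal_normSq_add_sq_rpow_neg ht v).fderiv
  rw [hfderiv]
  refine (((integrable_norm_mul_normSq_add_sq_rpow_neg hs' ht).const_mul (2 * (s - 1))).mono'
    ?_ (ae_of_all _ fun v => ?_))
  · have hac : Continuous fun v : V => -(2 * (s - 1)) * (‖v‖ ^ 2 + t ^ 2) ^ (-(s - 1) - 1) :=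
      continuous_const.mul (continuous_normSq_add_sq_rpow ht _)
    exact (continuous_const.clm_comp
      (hac.smul (innerSL ℝ (E := V)).continuous)).aestronglyMeasurable
  · -- the operator norm of `u ↦ (a ⟪v, u⟫ : ℂ)` is at most `|a| ‖v‖`
    have hr : 0 < ‖v‖ ^ 2 + t ^ 2 := by positivity
    have hM : 0 ≤ 2 * (s - 1) * (‖v‖ * (‖v‖ ^ 2 + t ^ 2) ^ (-s)) := by positivity
    refine ContinuousLinearMap.opNorm_le_bound _ hM fun u => ?_
    rw [ContinuousLinearMap.comp_apply, smul_apply, innerSL_apply_apply, Complex.ofRealCLM_apply,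
      smul_eq_mul, Complex.norm_real, Real.norm_eq_abs, abs_mul, abs_mul, abs_neg,
      abs_of_pos (by positivity : (0 : ℝ) < 2 * (s - 1)),
      abs_of_nonneg (Real.rpow_nonneg hr.le _), show -(s - 1) - 1 = -s by ring]
    calc 2 * (s - 1) * (‖v‖ ^ 2 + t ^ 2) ^ (-s) * |⟪v, u⟫|
        ≤ 2 * (s - 1) * (‖v‖ ^ 2 + t ^ 2) ^ (-s) * (‖v‖ * ‖u‖) :=
          mul_le_mul_of_nonneg_left (abs_real_inner_le_norm v u) (by positivity)
      _ = 2 * (s - 1) * (‖v‖ * (‖v‖ ^ 2 + t ^ 2) ^ (-s)) * ‖u‖ := by ring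

/-- **Fourier transform of the vector power kernel.** For `s - 1 > d/2`, `t > 0` and `c, w ∈ V`,
`𝓕[⟪c, ·⟫ (‖·‖² + t²)^{-s}](w) = -(π i ⟪c, w⟫ / (s - 1)) · 𝓕[(‖·‖² + t²)^{-(s-1)}](w)`:
the vector kernel is `-(2(s-1))⁻¹ ∂_c (‖·‖² + t²)^{-(s-1)}`, and the Fourier transform of a
Fréchet derivative is `𝓕 (∂_c f)(w) = 2πi ⟪c, w⟫ 𝓕 f (w)` (Mathlib's `Real.fourier_fderiv`).
[cite: SteinWeiss1971, Ch. I §1] -/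
theorem fourierIntegral_inner_mul_normSq_add_sq_rpow_neg {s t : ℝ}
    (hs : (Module.finrank ℝ V : ℝ) / 2 < s - 1) (ht : 0 < t) (c w : V) :
    𝓕 (fun v : V => ((⟪c, v⟫ * (‖v‖ ^ 2 + t ^ 2) ^ (-s) : ℝ) : ℂ)) w =
      -(Real.pi * Complex.I * (⟪c, w⟫ : ℝ) / ((s - 1 : ℝ) : ℂ)) *
        𝓕 (fun v : V => (((‖v‖ ^ 2 + t ^ 2) ^ (-(s - 1)) : ℝ) : ℂ)) w := by
  have hd0 : (0 : ℝ) ≤ (Module.finrank ℝ V : ℝ) / 2 := by positivity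
  have hs1 : 0 < s - 1 := hd0.trans_lt hs
  have hσ0 : (s : ℂ) - 1 ≠ 0 := by
    rw [← Complex.ofReal_one, ← Complex.ofReal_sub]
    exact_mod_cast hs1.ne'
  -- the scalar kernel of exponent `s - 1`, complexified
  set f : V → ℂ := fun v => (((‖v‖ ^ 2 + t ^ 2) ^ (-(s - 1)) : ℝ) : ℂ) with hf
  have hderiv : ∀ v : V, HasFDerivAt f (Complex.ofRealCLM.comp
      ((-(2 * (s - 1)) * (‖v‖ ^ 2 + t ^ 2) ^ (-(s - 1) - 1)) • (innerSL ℝ v))) v :=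
    fun v => hasFDerivAt_ofReal_normSq_add_sq_rpow_neg ht.ne' v
  have hfi : Integrable f := (integrable_normSq_add_sq_rpow_neg hs ht.ne').ofReal
  have hfd : Differentiable ℝ f := fun v => (hderiv v).differentiableAt
  have hfd' : Integrable (fderiv ℝ f) := integrable_fderiv_normSq_add_sq_rpow_neg hs ht.ne'
  -- Mathlib: the Fourier transform of the gradient, evaluated at `w` in the direction `c`
  have key : 𝓕 (fun v => fderiv ℝ f v c) w = 2 * π * Complex.I * (⟪c, w⟫ : ℝ) * 𝓕 f w := by
    have h1 : 𝓕 (fderiv ℝ f) w c = 𝓕 (fun v => fderiv ℝ f v c) w :=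
      Real.fourierIntegral_continuousLinearMap_apply' (L := innerSL ℝ) hfd'
    rw [← h1, Real.fourier_fderiv hfi hfd hfd', VectorFourier.fourierSMulRight_apply,
      neg_apply, neg_apply, innerSL_apply_apply, real_inner_comm c w, Complex.real_smul,
      smul_eq_mul]
    push_cast
    ring
  -- pointwise: the vector kernel is `-(2(s-1))⁻¹ ∂_c f`
  have hpt : (fun v : V => ((⟪c, v⟫ * (‖v‖ ^ 2 + t ^ 2) ^ (-s) : ℝ) : ℂ)) =
      fun v => (-(2 * ((s - 1 : ℝ) : ℂ)))⁻¹ * fderiv ℝ f v c := by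
    funext v
    rw [(hderiv v).fderiv, ContinuousLinearMap.comp_apply, smul_apply, innerSL_apply_apply,
      Complex.ofRealCLM_apply, real_inner_comm c v, show -(s - 1) - 1 = -s by ring, smul_eq_mul]
    push_cast
    field_simp
  -- constants come out of the Fourier integral
  have hsmul : 𝓕 (fun v => (-(2 * ((s - 1 : ℝ) : ℂ)))⁻¹ * fderiv ℝ f v c) w =
      (-(2 * ((s - 1 : ℝ) : ℂ)))⁻¹ * 𝓕 (fun v => fderiv ℝ f v c) w := by
    rw [Real.fourier_eq, Real.fourier_eq, ← integral_const_mul]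
    congr 1 with v
    simp only [Circle.smul_def, smul_eq_mul]
    ring
  rw [hpt, hsmul, key]
  push_cast
  field_simp

end Literature.Analysis.Fourier
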